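/-
Origin: expansion seat `prover-pub-hodgecm-mc-carch-1-g4-0`, handover #CA48 2026-08-20T10:45Z md5 08a8f37d5952 (160 l., 8 decls; NEW additive leaf; imports installed RUN-45 #CA32 Model.ArchKTypeOfLambdaDef + #CA44 (this kit); RUN 49; INSTALL after #CA44; cert certs/ax-ArchKTypeOfLambdaDef34-08a8f37d5952.log: rc 0 / 23 s / 0 warnings / trio) (`HOME/mc/pub-hodgecm-mc-carch-1/pkg49/HodgeCM/Model/ArchKTypeOfLambdaDef34.lean`, md5 08a8f37d5952, 160 lines);
landed by the gen-19 packager (p-g19) in gate run 49 as `HodgeCM/Model/ArchKTypeOfLambdaDef34.lean` (verbatim).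
-/
/-
Copyright (c) 2026. Released under Apache 2.0 license as described in the file LICENSE.
Cell pub-hodgecm, MODEL layer (construction prover mc-carch-1, gen 4), BINDER-OWNERS row 12 `C`, junction (C-Λ) for the CONJUGATED
plane: the see-saw factor of line 2 at the definite places is `det^{ℓ′}` — the (34) twin of RUN-45 #CA32 `ArchKTypeOfLambdaDef`.
-/
import Summits.HodgeConjecture.HodgeCM.Model.ArchKTypeOfLambdaDef
import Summits.HodgeConjecture.HodgeCM.Model.ArchKTypeOfDefiniteChar34

/-!
# (C-Λ)′ at the definite places: `defLambdaCharConj`, `defLambdaExponentConj`, the (c5)₂ socket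

Verbatim #CA32 on the conjugated plane (`cmLineChar₀ ↦ cmConjLineChar₀`, `hGR₀/hGR₁ ↦ hGR₂/hGR₃`, `η₀ ↦ η₂`, `archScalar_zeroG ↦ archScalar_twoG`
of #CA44; the local-group identification `archLocal_eq_form`/`placeEntries` and #CA31 `U3FormChar` are line-free):
`defLambdaCharConj V S hGR hGR₂ hGR₃ b : U(V)_{w b} →* ℂˣ` (`u ↦ χ₂′((archSingle (w b) u)^𝔸, 1)`), `continuous_defLambdaCharConj` (sinst
`continuous_cmConjLineChar₀_of_signs`), **`exists_defLambdaExponentConj` / `defLambdaExponentConj V S hGR hGR₂ hGR₃ h₁W b hb : ℤ` /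
`defLambdaCharConj_eq_zpow`** (`b ≠ v₁`), `archScalar_twoG_archSingle` (rfl split of #CA44's scalar) and the socket **`hdef_two_of_archType`**
(types `m b + ℓ′_b + a b = 0` ⇒ the `hdef` input of #CA44 `harch_two_of_defType(_coset)G`).  These are the names the R2 pin's line-2
table reads (`nVR (w b) − n₃R (w b) + ℓ′_b + a₂ b = 0`, see the (C-Σ)′ consistency).
Nothing is cited and nothing is minted; 0 records, 0 `def … : Prop`.
-/

set_option autoImplicit false

noncomputable section

open NumberField NumberField.InfinitePlace NumberField.mixedEmbedding IsDedekindDomain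
open scoped Matrix Classical
open ComplexConjugate
open Literature.NumberTheory.Automorphic Literature.NumberTheory.Automorphic.UnitaryGroup Literature.NumberTheory.Weil1964
open Literature.NumberTheory.GelbartRogawski1991 Literature.NumberTheory.GelbartRogawski1991.UnitaryDualPair
open HodgeCM.Adelic HodgeCM.PerL34 HodgeCM.Model.HypCensus HodgeCM.Model.ArchSideTerm

namespace HodgeCM.Model

section LambdaDefConj

variable {L : CMField} {ι₁ : L →+* ℂ} (V : HermSpace3 L ι₁) (S : StubTree.SeesawDatum L)
variable
  (hGR : (cmSplittingDatum (L : Type) finProdFinEquiv (frameD V) (frameD_real V) (frameD_ne V) (dW S) (dW_real S) (dW_ne S)).CompatibleSplitting)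
  (hGR₂ : (cmSplittingDatum (L : Type) (e₁) (frameD V) (frameD_real V) (frameD_ne V) (lineVec (L : Type) (dW' S 0))
    (fun _ => dW'_real S 0) (fun _ => dW'_ne S 0)).CompatibleSplitting)
  (hGR₃ : (cmSplittingDatum (L : Type) (e₁) (frameD V) (frameD_real V) (frameD_ne V) (lineVec (L : Type) (dW' S 1))
    (fun _ => dW'_real S 1) (fun _ => dW'_ne S 1)).CompatibleSplitting)
  (η₂ : CMAdelic (L : Type) (frameD V) × CMAdelicOne (L : Type) →* ℂˣ)

/-! ## § 1 The see-saw factor at a place -/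

/-- **`λ_b : U(V)(L_b) →* ℂˣ`, `u ↦ χ₂′((archSingle (w b) u)^𝔸, 1)`** — the `cmConjLineChar₀`-part of #CA44's `archScalar_twoG` on one-place elements. -/
def defLambdaCharConj (b : {v : InfinitePlace ↥(maximalRealSubfield L) // v.IsReal}) :
    ↥(UnitaryGroup.archLocal (L : Type) 3 (Matrix.diagonal (frameD V)) (cmPlaceOver (L : Type) b)) →* ℂˣ :=
  (cmConjLineChar₀ (L : Type) finProdFinEquiv e₁ (frameD V) (frameD_real V) (frameD_ne V) (dW S) (dW_real S) (dW_ne S) (dW' S) (dW'_real S)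
      (dW'_ne S) S.isoGL (isoGL_hg₀ S) hGR hGR₂ hGR₃).comp
    (MonoidHom.prod ((UnitaryGroup.archToAdelic (↥(maximalRealSubfield L)) L (IsCMField.complexConj L) 3 (Matrix.diagonal (frameD V))).comp
      (UnitaryGroup.archSingle (↥(maximalRealSubfield L)) L (IsCMField.complexConj L) 3 (Matrix.diagonal (frameD V))
        (IsCMField.complexConj_ne_one L) (NumberField.complexConj_smul_infinitePlace (L : Type)) (cmPlaceOver (L : Type) b))) 1)

/-- (Ported verbatim from the HodgeCMPerL package; no docstring in the source.) -/
theorem defLambdaCharConj_apply (b : {v : InfinitePlace ↥(maximalRealSubfield L) // v.IsReal})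
    (u : UnitaryGroup.archLocal (L : Type) 3 (Matrix.diagonal (frameD V)) (cmPlaceOver (L : Type) b)) :
    defLambdaCharConj V S hGR hGR₂ hGR₃ b u =
      cmConjLineChar₀ (L : Type) finProdFinEquiv e₁ (frameD V) (frameD_real V) (frameD_ne V) (dW S) (dW_real S) (dW_ne S) (dW' S) (dW'_real S)
        (dW'_ne S) S.isoGL (isoGL_hg₀ S) hGR hGR₂ hGR₃
        (UnitaryGroup.archToAdelic (↥(maximalRealSubfield L)) L (IsCMField.complexConj L) 3 (Matrix.diagonal (frameD V))
          (UnitaryGroup.archSingle (↥(maximalRealSubfield L)) L (IsCMField.complexConj L) 3 (Matrix.diagonal (frameD V))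
            (IsCMField.complexConj_ne_one L) (NumberField.complexConj_smul_infinitePlace (L : Type)) (cmPlaceOver (L : Type) b) u), 1) :=
  rfl

/-- the SPLIT of #CA27's line-2 scalar on one-place elements: `(η₂-part) · λ_b` (definitional). -/
theorem archScalar_twoG_archSingle (b : {v : InfinitePlace ↥(maximalRealSubfield L) // v.IsReal})
    (u : UnitaryGroup.archLocal (L : Type) 3 (Matrix.diagonal (frameD V)) (cmPlaceOver (L : Type) b)) :
    archScalar_twoG V S hGR hGR₂ hGR₃ η₂
        (UnitaryGroup.archSingle (↥(maximalRealSubfield L)) L (IsCMField.complexConj L) 3 (Matrix.diagonal (frameD V))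
          (IsCMField.complexConj_ne_one L) (NumberField.complexConj_smul_infinitePlace (L : Type)) (cmPlaceOver (L : Type) b) u) =
      η₂ (UnitaryGroup.archToAdelic (↥(maximalRealSubfield L)) L (IsCMField.complexConj L) 3 (Matrix.diagonal (frameD V))
          (UnitaryGroup.archSingle (↥(maximalRealSubfield L)) L (IsCMField.complexConj L) 3 (Matrix.diagonal (frameD V))
            (IsCMField.complexConj_ne_one L) (NumberField.complexConj_smul_infinitePlace (L : Type)) (cmPlaceOver (L : Type) b) u), 1) *
        defLambdaCharConj V S hGR hGR₂ hGR₃ b u :=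
  rfl

variable (h₁W : (∀ j, 0 < (ι₁ (dW S j)).re) ∨ ∀ j, (ι₁ (dW S j)).re < 0)

include h₁W in
/-- `u ↦ (λ_b u : ℂ)` is continuous on the local group. -/
theorem continuous_defLambdaCharConj (b : {v : InfinitePlace ↥(maximalRealSubfield L) // v.IsReal}) :
    Continuous fun u : UnitaryGroup.archLocal (L : Type) 3 (Matrix.diagonal (frameD V)) (cmPlaceOver (L : Type) b) =>
      ((defLambdaCharConj V S hGR hGR₂ hGR₃ b u : ℂˣ) : ℂ) :=
  (continuous_cmConjLineChar₀_of_signs (L : Type) finProdFinEquiv e₁ (frameD V) (frameD_real V) (frameD_ne V) (dW S) (dW_real S)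
    (dW_ne S) hGR (dW' S) (dW'_real S) (dW'_ne S) S.isoGL (isoGL_hg₀ S) hGR₂ hGR₃ ι₁ (frameD_sign_ι₁' V) h₁W (frameD_sign_of_ne V)).comp
    (((UnitaryGroup.continuous_archToAdelic (↥(maximalRealSubfield L)) L (IsCMField.complexConj L) 3 (Matrix.diagonal (frameD V))).comp
      (UnitaryGroup.continuous_archSingle (↥(maximalRealSubfield L)) L (IsCMField.complexConj L) 3 (Matrix.diagonal (frameD V))
        (IsCMField.complexConj_ne_one L) (NumberField.complexConj_smul_infinitePlace (L : Type)) (cmPlaceOver (L : Type) b))).prodMk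
      continuous_const)

/-! ## § 2–3 The exponent of record at a definite place -/

include h₁W in
/-- **(Λ-def)**: at a definite place the see-saw factor of line 2 is `det^ℓ` for ONE integer `ℓ`. -/
theorem exists_defLambdaExponentConj (b : {v : InfinitePlace ↥(maximalRealSubfield L) // v.IsReal}) (hb : b ≠ HypCensus.cmPlace (L : Type) ι₁) :
    ∃ ℓ : ℤ, ∀ u : UnitaryGroup.archLocal (L : Type) 3 (Matrix.diagonal (frameD V)) (cmPlaceOver (L : Type) b),
      ((defLambdaCharConj V S hGR hGR₂ hGR₃ b u : ℂˣ) : ℂ) =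
        (((u : UnitaryGroup.archLocal (L : Type) 3 (Matrix.diagonal (frameD V)) (cmPlaceOver (L : Type) b)) : GL (Fin 3) ℂ) :
          Matrix (Fin 3) (Fin 3) ℂ).det ^ ℓ := by
  -- read the character on `unitaryGroupOfForm conj (diagonal h)` through the identity of subgroups
  let e := MulEquiv.subgroupCongr (archLocal_eq_form V b)
  let χ : ↥(unitaryGroupOfForm (starRingEnd ℂ) (Matrix.diagonal (placeEntries V b))) →* ℂˣ :=
    (defLambdaCharConj V S hGR hGR₂ hGR₃ b).comp e.symm.toMonoidHom
  have he : Continuous fun g : ↥(unitaryGroupOfForm (starRingEnd ℂ) (Matrix.diagonal (placeEntries V b))) => e.symm g :=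
    Continuous.subtype_mk continuous_subtype_val _
  have hχ : Continuous fun g => ((χ g : ℂˣ) : ℂ) := (continuous_defLambdaCharConj V S hGR hGR₂ hGR₃ h₁W b).comp he
  obtain ⟨m, hm⟩ := U3FormChar.exists_zpow_of_continuous_form (placeEntries V b) (placeEntries_real V b) (placeEntries_sign V hb) χ hχ
  refine ⟨m, fun u => ?_⟩
  have h := hm (e u)
  have h1 : e.symm (e u) = u := e.symm_apply_apply u
  simp only [χ, MonoidHom.comp_apply, MulEquiv.coe_toMonoidHom, h1] at h
  exact h

/-- **the exponent OF RECORD `ℓ_b`** of the see-saw factor at the definite place `b` (one `Classical.choose`). -/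
def defLambdaExponentConj (b : {v : InfinitePlace ↥(maximalRealSubfield L) // v.IsReal}) (hb : b ≠ HypCensus.cmPlace (L : Type) ι₁) : ℤ :=
  (exists_defLambdaExponentConj V S hGR hGR₂ hGR₃ h₁W b hb).choose

/-- (Ported verbatim from the HodgeCMPerL package; no docstring in the source.) -/
theorem defLambdaCharConj_eq_zpow (b : {v : InfinitePlace ↥(maximalRealSubfield L) // v.IsReal}) (hb : b ≠ HypCensus.cmPlace (L : Type) ι₁)
    (u : UnitaryGroup.archLocal (L : Type) 3 (Matrix.diagonal (frameD V)) (cmPlaceOver (L : Type) b)) :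
    ((defLambdaCharConj V S hGR hGR₂ hGR₃ b u : ℂˣ) : ℂ) =
      (((u : UnitaryGroup.archLocal (L : Type) 3 (Matrix.diagonal (frameD V)) (cmPlaceOver (L : Type) b)) : GL (Fin 3) ℂ) :
        Matrix (Fin 3) (Fin 3) ℂ).det ^ defLambdaExponentConj V S hGR hGR₂ hGR₃ h₁W b hb :=
  (exists_defLambdaExponentConj V S hGR hGR₂ hGR₃ h₁W b hb).choose_spec u

/-! ## § 4 The (c5)₂ socket -/

/-- **THE (c5)₂ SOCKET.**  If the η₂-part of the line-2 scalar is `det(u)^{m b}` on every `U(V)(L_b)`, `b ≠ v₁`, and the types satisfy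
`m b + ℓ_b + a b = 0`, then the `hdef` hypothesis of #CA27 `harch_zero_of_defTypeG` holds (so `harch₂` follows from the exponent table `hω`). -/
theorem hdef_two_of_archType (a m : {v : InfinitePlace ↥(maximalRealSubfield L) // v.IsReal} → ℤ)
    (hη : ∀ b : {v : InfinitePlace ↥(maximalRealSubfield L) // v.IsReal}, b ≠ HypCensus.cmPlace (L : Type) ι₁ →
      ∀ u : UnitaryGroup.archLocal (L : Type) 3 (Matrix.diagonal (frameD V)) (cmPlaceOver (L : Type) b),
        ((η₂ (UnitaryGroup.archToAdelic (↥(maximalRealSubfield L)) L (IsCMField.complexConj L) 3 (Matrix.diagonal (frameD V))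
            (UnitaryGroup.archSingle (↥(maximalRealSubfield L)) L (IsCMField.complexConj L) 3 (Matrix.diagonal (frameD V))
              (IsCMField.complexConj_ne_one L) (NumberField.complexConj_smul_infinitePlace (L : Type)) (cmPlaceOver (L : Type) b) u), 1) : ℂˣ) : ℂ) =
          (((u : UnitaryGroup.archLocal (L : Type) 3 (Matrix.diagonal (frameD V)) (cmPlaceOver (L : Type) b)) : GL (Fin 3) ℂ) :
            Matrix (Fin 3) (Fin 3) ℂ).det ^ m b)
    (hm : ∀ b : {v : InfinitePlace ↥(maximalRealSubfield L) // v.IsReal}, ∀ hb : b ≠ HypCensus.cmPlace (L : Type) ι₁,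
      m b + defLambdaExponentConj V S hGR hGR₂ hGR₃ h₁W b hb + a b = 0) :
    ∀ b : {v : InfinitePlace ↥(maximalRealSubfield L) // v.IsReal}, b ≠ HypCensus.cmPlace (L : Type) ι₁ →
      ∀ u : UnitaryGroup.archLocal (L : Type) 3 (Matrix.diagonal (frameD V)) (cmPlaceOver (L : Type) b),
        ((archScalar_twoG V S hGR hGR₂ hGR₃ η₂
            (UnitaryGroup.archSingle (↥(maximalRealSubfield L)) L (IsCMField.complexConj L) 3 (Matrix.diagonal (frameD V))
              (IsCMField.complexConj_ne_one L) (NumberField.complexConj_smul_infinitePlace (L : Type)) (cmPlaceOver (L : Type) b) u) : ℂˣ) : ℂ) *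
          (((u : UnitaryGroup.archLocal (L : Type) 3 (Matrix.diagonal (frameD V)) (cmPlaceOver (L : Type) b)) : GL (Fin 3) ℂ) :
              Matrix (Fin 3) (Fin 3) ℂ).det ^ a b = 1 := by
  intro b hb u
  have hdet : (((u : UnitaryGroup.archLocal (L : Type) 3 (Matrix.diagonal (frameD V)) (cmPlaceOver (L : Type) b)) : GL (Fin 3) ℂ) :
      Matrix (Fin 3) (Fin 3) ℂ).det ≠ 0 := by
    rw [← Matrix.GeneralLinearGroup.val_det_apply]
    exact Units.ne_zero _
  rw [archScalar_twoG_archSingle, Units.val_mul, hη b hb u, defLambdaCharConj_eq_zpow V S hGR hGR₂ hGR₃ h₁W b hb u,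
    ← zpow_add₀ hdet, ← zpow_add₀ hdet, hm b hb, zpow_zero]

end LambdaDefConj

end HodgeCM.Model

end
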